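import Mathlib
import Literature.Analysis.ODE.InverseSquareTailDominant

/-!
# Particular solutions of `a'' = (ℓ(ℓ+1)/x² + W) a + g` with power asymptotics (variation of parameters)

Analysis/ODE support file (everything proved, no definitions), continuing
`InverseSquareTailDominant.lean`. Given the fundamental system `u ~ x^{-ℓ}`, `u₂ ~ x^{ℓ+1}/(2ℓ+1)`
(Wronskian 1) of the homogeneous equation on `[X, ∞)` and a forcing `g` continuous on `[X, ∞)`
with `|g − γ x^q| ≤ K_g x^{q−1/2}`, where `−ℓ−1 ≤ q < ℓ−1`, the particular solution

  `a = −u₂ ∫_x^∞ u g − u ∫_X^x u₂ g`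

solves `a'' = (ℓ(ℓ+1)/x² + W) a + g` on `(X, ∞)` and is an asymptotic monomial
`a = κ x^{q+2} + O(x^{q+3/2})`, `a' = κ(q+2) x^{q+1} + O(x^{q+1/2})` with
`κ = −γ/((ℓ−q−1)(q+ℓ+2))` (`exists_particular_inverseSquareTail`). With `q = 2m−2−ℓ`
(`1 ≤ m ≤ ℓ`) this is the descent step `t^{N−2m+2} ↦ t^{N−2m}` of the `t`-polynomial solutions
`Σ a_i(x) tⁱ` of the Regge–Wheeler equation at the far end (`κ = −γ/(2m(2ℓ−2m+1))`), route
PhotonSphereChannels, `FixedModeChannels`, stmt-FinalStateConjecture-10048. Folklore (Hartman,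
*Ordinary Differential Equations*, Ch. IV §8, Ch. X §1).
-/

noncomputable section

namespace Literature.Analysis.ODE

open MeasureTheory Set Filter Topology Real

variable {W : ℝ → ℝ} {X : ℝ}

/-- **Particular solution with power asymptotics (descent step).** See the module docstring. [folklore] -/
theorem exists_particular_inverseSquareTail (ℓ : ℕ) (hX : 1 ≤ X)
    {u u' u₂ u₂' : ℝ → ℝ} {K : ℝ}
    (huc : ContinuousOn u (Ici X)) (hu'c : ContinuousOn u' (Ici X)) (hu₂c : ContinuousOn u₂ (Ici X))
    (hu₂'c : ContinuousOn u₂' (Ici X))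
    (hud : ∀ x, X < x → HasDerivAt u (u' x) x)
    (hu'd : ∀ x, X < x → HasDerivAt u' (((ℓ : ℝ) * (ℓ + 1) / x ^ 2 + W x) * u x) x)
    (hu₂d : ∀ x, X < x → HasDerivAt u₂ (u₂' x) x)
    (hu₂'d : ∀ x, X < x → HasDerivAt u₂' (((ℓ : ℝ) * (ℓ + 1) / x ^ 2 + W x) * u₂ x) x)
    (hwr : ∀ x, X ≤ x → u x * u₂' x - u' x * u₂ x = 1)
    (hu_as : ∀ x, X ≤ x → |u x - x ^ (-(ℓ : ℝ))| ≤ K * x ^ (-(ℓ : ℝ) - 1 / 2))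
    (hu'_as : ∀ x, X ≤ x → |u' x - (-(ℓ : ℝ)) * x ^ (-(ℓ : ℝ) - 1)| ≤ K * x ^ (-(ℓ : ℝ) - 1 - 1 / 2))
    (hu₂_as : ∀ x, X ≤ x → |u₂ x - (2 * (ℓ : ℝ) + 1)⁻¹ * x ^ ((ℓ : ℝ) + 1)| ≤ K * x ^ ((ℓ : ℝ) + 1 - 1 / 2))
    (hu₂'_as : ∀ x, X ≤ x → |u₂' x - ((ℓ : ℝ) + 1) / (2 * ℓ + 1) * x ^ (ℓ : ℝ)|
      ≤ K * x ^ ((ℓ : ℝ) - 1 / 2))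
    {g : ℝ → ℝ} {γ q Kg : ℝ} (hgc : ContinuousOn g (Ici X)) (hq1 : q < ℓ - 1) (hq2 : -(ℓ : ℝ) - 1 ≤ q)
    (hg_as : ∀ x, X ≤ x → |g x - γ * x ^ q| ≤ Kg * x ^ (q - 1 / 2)) :
    ∃ a a' : ℝ → ℝ, ∃ K' : ℝ, ContinuousOn a (Ici X) ∧ ContinuousOn a' (Ici X)
      ∧ (∀ x, X < x → HasDerivAt a (a' x) x)
      ∧ (∀ x, X < x → HasDerivAt a' (((ℓ : ℝ) * (ℓ + 1) / x ^ 2 + W x) * a x + g x) x)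
      ∧ (∀ x, X ≤ x → |a x - (-γ / ((ℓ - q - 1) * (q + ℓ + 2))) * x ^ (q + 2)|
          ≤ K' * x ^ (q + 2 - 1 / 2))
      ∧ (∀ x, X ≤ x → |a' x - (-γ / ((ℓ - q - 1) * (q + ℓ + 2)) * (q + 2)) * x ^ (q + 1)|
          ≤ K' * x ^ (q + 1 - 1 / 2)) := by
  have hX0 : 0 < X := lt_of_lt_of_le one_pos hX
  -- (1) the integrands `u g` (decaying) and `u₂ g` (growing) in the power scale
  have hu_as' : ∀ x, X ≤ x → |u x - 1 * x ^ (-(ℓ : ℝ))| ≤ K * x ^ (-(ℓ : ℝ) - 1 / 2) := by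
    intro x hx; rw [one_mul]; exact hu_as x hx
  have hug_as : ∀ x, X ≤ x → |u x * g x - 1 * γ * x ^ (-(ℓ : ℝ) + q)|
      ≤ (K * (|γ| + Kg) + |(1 : ℝ)| * Kg) * x ^ (-(ℓ : ℝ) + q - 1 / 2) :=
    fun x hx => asymp_mul hX hu_as' hg_as hx
  have hu₂g_as : ∀ x, X ≤ x → |u₂ x * g x - (2 * (ℓ : ℝ) + 1)⁻¹ * γ * x ^ ((ℓ : ℝ) + 1 + q)|
      ≤ (K * (|γ| + Kg) + |(2 * (ℓ : ℝ) + 1)⁻¹| * Kg) * x ^ ((ℓ : ℝ) + 1 + q - 1 / 2) :=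
    fun x hx => asymp_mul hX hu₂_as hg_as hx
  have hugc : ContinuousOn (fun y => u y * g y) (Ici X) := huc.mul hgc
  have hu₂gc : ContinuousOn (fun y => u₂ y * g y) (Ici X) := hu₂c.mul hgc
  -- (2) the tail `J₁ = ∫_x^∞ u g`
  have hp1 : -(ℓ : ℝ) + q < -1 := by linarith
  have hJ₁ := fun x (hx : X ≤ x) =>
    asymp_integral_Ioi (a := 1 * γ) hX hugc hp1 (by simpa [one_mul] using hug_as) hx
  have hJ₁i : IntegrableOn (fun y => u y * g y) (Ioi X) := (hJ₁ X le_rfl).1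
  set J₁ : ℝ → ℝ := fun x => ∫ y in Ioi x, u y * g y with hJ₁def
  have hJ₁c : ContinuousOn J₁ (Ici X) := continuousOn_integral_Ioi hugc hJ₁i
  have hJ₁d : ∀ x, X < x → HasDerivAt J₁ (-(u x * g x)) x := fun x hx =>
    hasDerivAt_integral_Ioi hugc hJ₁i hx
  -- (3) the primitive `J₂ = ∫_X^x u₂ g` (clamped integrand)
  set f₂ : ℝ → ℝ := fun y => u₂ (max y X) * g (max y X) with hf₂
  have hf₂c : Continuous f₂ := continuous_comp_max_of_continuousOn (f := fun y => u₂ y * g y) hu₂gc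
  have hf₂eq : ∀ y, X ≤ y → f₂ y = u₂ y * g y := fun y hy => by simp only [hf₂, max_eq_left hy]
  set J₂ : ℝ → ℝ := fun x => ∫ y in X..x, f₂ y with hJ₂def
  have hJ₂c : Continuous J₂ :=
    intervalIntegral.continuous_primitive (fun a b => hf₂c.intervalIntegrable a b) X
  have hJ₂d : ∀ x, X < x → HasDerivAt J₂ (u₂ x * g x) x := by
    intro x hx
    have h := intervalIntegral.integral_hasDerivAt_right (hf₂c.intervalIntegrable X x)
      (hf₂c.stronglyMeasurableAtFilter _ _) hf₂c.continuousAt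
    rw [hf₂eq x hx.le] at h
    exact h
  have hf₂_as : ∀ x, X ≤ x → |f₂ x - (2 * (ℓ : ℝ) + 1)⁻¹ * γ * x ^ ((ℓ : ℝ) + 1 + q)|
      ≤ (K * (|γ| + Kg) + |(2 * (ℓ : ℝ) + 1)⁻¹| * Kg) * x ^ ((ℓ : ℝ) + 1 + q - 1 / 2) := by
    intro x hx; rw [hf₂eq x hx]; exact hu₂g_as x hx
  have hp2 : 0 ≤ (ℓ : ℝ) + 1 + q := by linarith
  have hJ₂ := fun x (hx : X ≤ x) => asymp_integral_interval hX hf₂c.continuousOn hp2 hf₂_as hx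
  -- (4) the particular solution
  set a : ℝ → ℝ := fun x => -(u₂ x * J₁ x) - u x * J₂ x with ha
  set a' : ℝ → ℝ := fun x => -(u₂' x * J₁ x) - u' x * J₂ x with ha'
  -- (5) asymptotics of `J₁`, `J₂` in standard form
  have hlq : 0 < (ℓ : ℝ) - q - 1 := by linarith
  have hlq2 : 0 < q + ℓ + 2 := by linarith
  have hn : (2 * (ℓ : ℝ) + 1) ≠ 0 := by positivity
  set K₁ : ℝ := K * (|γ| + Kg) + Kg with hK₁
  set K₂ : ℝ := K * (|γ| + Kg) + |(2 * (ℓ : ℝ) + 1)⁻¹| * Kg with hK₂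
  set c₁ : ℝ := γ / (ℓ - q - 1) with hc₁
  set c₂ : ℝ := (2 * (ℓ : ℝ) + 1)⁻¹ * γ / (q + ℓ + 2) with hc₂
  have hJ₁_as : ∀ x, X ≤ x → |J₁ x - c₁ * x ^ (-(ℓ : ℝ) + q + 1)|
      ≤ K₁ / (-(-(ℓ : ℝ) + q) - 1 / 2) * x ^ (-(ℓ : ℝ) + q + 1 - 1 / 2) := by
    intro x hx
    have h := (hJ₁ x hx).2
    have e1 : (1 : ℝ) * γ / (-(-(ℓ : ℝ) + q) - 1) = c₁ := by
      rw [hc₁, one_mul]; congr 1; ring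
    rw [e1, show (-(ℓ : ℝ) + q + 1 / 2) = (-(ℓ : ℝ) + q + 1 - 1 / 2) by ring] at h
    exact h
  have hJ₂_as : ∀ x, X ≤ x → |J₂ x - c₂ * x ^ ((ℓ : ℝ) + 1 + q + 1)|
      ≤ (|(2 * (ℓ : ℝ) + 1)⁻¹ * γ| * Real.sqrt X / ((ℓ : ℝ) + 1 + q + 1)
          + K₂ / ((ℓ : ℝ) + 1 + q + 1 - 1 / 2))
        * x ^ ((ℓ : ℝ) + 1 + q + 1 - 1 / 2) := by
    intro x hx
    have h := hJ₂ x hx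
    have e1 : (2 * (ℓ : ℝ) + 1)⁻¹ * γ / ((ℓ : ℝ) + 1 + q + 1) = c₂ := by
      rw [hc₂]; congr 1; ring
    rw [e1, show ((ℓ : ℝ) + 1 + q + 1 / 2) = ((ℓ : ℝ) + 1 + q + 1 - 1 / 2) by ring] at h
    exact h
  -- (6) the four products
  have hP1 := fun x (hx : X ≤ x) => asymp_mul hX hu₂_as hJ₁_as hx
  have hP2 := fun x (hx : X ≤ x) => asymp_mul hX hu_as' hJ₂_as hx
  have hP3 := fun x (hx : X ≤ x) => asymp_mul hX hu₂'_as hJ₁_as hx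
  have hP4 := fun x (hx : X ≤ x) => asymp_mul hX hu'_as hJ₂_as hx
  -- the leading coefficients
  have hκ : -((2 * (ℓ : ℝ) + 1)⁻¹ * c₁ + 1 * c₂) = -γ / ((ℓ - q - 1) * (q + ℓ + 2)) := by
    rw [hc₁, hc₂]
    field_simp
    ring
  have hκ' : -(((ℓ : ℝ) + 1) / (2 * ℓ + 1) * c₁ + -(ℓ : ℝ) * c₂)
      = -γ / ((ℓ - q - 1) * (q + ℓ + 2)) * (q + 2) := by
    rw [hc₁, hc₂]
    field_simp
    ring
  set K₁' : ℝ := K₁ / (-(-(ℓ : ℝ) + q) - 1 / 2) with hK₁'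
  set K₂' : ℝ := |(2 * (ℓ : ℝ) + 1)⁻¹ * γ| * Real.sqrt X / ((ℓ : ℝ) + 1 + q + 1)
    + K₂ / ((ℓ : ℝ) + 1 + q + 1 - 1 / 2) with hK₂'
  set C1 : ℝ := K * (|c₁| + K₁') + |(2 * (ℓ : ℝ) + 1)⁻¹| * K₁' with hC1def
  set C2 : ℝ := K * (|c₂| + K₂') + |(1 : ℝ)| * K₂' with hC2def
  set C3 : ℝ := K * (|c₁| + K₁') + |((ℓ : ℝ) + 1) / (2 * ℓ + 1)| * K₁' with hC3def
  set C4 : ℝ := K * (|c₂| + K₂') + |(-(ℓ : ℝ))| * K₂' with hC4def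
  have hC1 : ∀ x, X ≤ x → |u₂ x * J₁ x - (2 * (ℓ : ℝ) + 1)⁻¹ * c₁ * x ^ (q + 2)|
      ≤ C1 * x ^ (q + 2 - 1 / 2) := by
    intro x hx
    have h := hP1 x hx
    rw [show ((ℓ : ℝ) + 1 + (-(ℓ : ℝ) + q + 1)) = q + 2 by ring] at h
    exact h
  have hC2 : ∀ x, X ≤ x → |u x * J₂ x - 1 * c₂ * x ^ (q + 2)| ≤ C2 * x ^ (q + 2 - 1 / 2) := by
    intro x hx
    have h := hP2 x hx
    rw [show (-(ℓ : ℝ) + ((ℓ : ℝ) + 1 + q + 1)) = q + 2 by ring] at h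
    exact h
  have hC3 : ∀ x, X ≤ x → |u₂' x * J₁ x - ((ℓ : ℝ) + 1) / (2 * ℓ + 1) * c₁ * x ^ (q + 1)|
      ≤ C3 * x ^ (q + 1 - 1 / 2) := by
    intro x hx
    have h := hP3 x hx
    rw [show ((ℓ : ℝ) + (-(ℓ : ℝ) + q + 1)) = q + 1 by ring] at h
    exact h
  have hC4 : ∀ x, X ≤ x → |u' x * J₂ x - -(ℓ : ℝ) * c₂ * x ^ (q + 1)| ≤ C4 * x ^ (q + 1 - 1 / 2) := by
    intro x hx
    have h := hP4 x hx
    rw [show (-(ℓ : ℝ) - 1 + ((ℓ : ℝ) + 1 + q + 1)) = q + 1 by ring] at h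
    exact h
  have hC10 : 0 ≤ C1 := nonneg_of_abs_le_mul_rpow hX0 (hC1 X le_rfl)
  have hC20 : 0 ≤ C2 := nonneg_of_abs_le_mul_rpow hX0 (hC2 X le_rfl)
  have hC30 : 0 ≤ C3 := nonneg_of_abs_le_mul_rpow hX0 (hC3 X le_rfl)
  have hC40 : 0 ≤ C4 := nonneg_of_abs_le_mul_rpow hX0 (hC4 X le_rfl)
  refine ⟨a, a', C1 + C2 + C3 + C4, ?_, ?_, fun x hx => ?_, fun x hx => ?_, fun x hx => ?_,
    fun x hx => ?_⟩
  · exact ((hu₂c.mul hJ₁c).neg).sub (huc.mul hJ₂c.continuousOn)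
  · exact ((hu₂'c.mul hJ₁c).neg).sub (hu'c.mul hJ₂c.continuousOn)
  · have h := (((hu₂d x hx).mul (hJ₁d x hx)).neg).sub ((hud x hx).mul (hJ₂d x hx))
    refine h.congr_deriv ?_
    simp only [ha']
    ring
  · have h := (((hu₂'d x hx).mul (hJ₁d x hx)).neg).sub ((hu'd x hx).mul (hJ₂d x hx))
    refine h.congr_deriv ?_
    have hw := hwr x hx.le
    simp only [ha]
    linear_combination (g x) * hw
  · have hx0 : 0 < x := hX0.trans_le hx
    have hxp : 0 ≤ x ^ (q + 2 - 1 / 2) := (Real.rpow_pos_of_pos hx0 _).le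
    have e : a x - -γ / ((ℓ - q - 1) * (q + ℓ + 2)) * x ^ (q + 2)
        = -(u₂ x * J₁ x - (2 * (ℓ : ℝ) + 1)⁻¹ * c₁ * x ^ (q + 2))
          - (u x * J₂ x - 1 * c₂ * x ^ (q + 2)) := by
      rw [← hκ]; simp only [ha]; ring
    rw [e]
    calc |-(u₂ x * J₁ x - (2 * (ℓ : ℝ) + 1)⁻¹ * c₁ * x ^ (q + 2)) - (u x * J₂ x - 1 * c₂ * x ^ (q + 2))|
        ≤ |-(u₂ x * J₁ x - (2 * (ℓ : ℝ) + 1)⁻¹ * c₁ * x ^ (q + 2))|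
          + |u x * J₂ x - 1 * c₂ * x ^ (q + 2)| := abs_sub _ _
      _ ≤ C1 * x ^ (q + 2 - 1 / 2) + C2 * x ^ (q + 2 - 1 / 2) := by
          rw [abs_neg]; exact add_le_add (hC1 x hx) (hC2 x hx)
      _ ≤ (C1 + C2 + C3 + C4) * x ^ (q + 2 - 1 / 2) := by nlinarith
  · have hx0 : 0 < x := hX0.trans_le hx
    have hxp : 0 ≤ x ^ (q + 1 - 1 / 2) := (Real.rpow_pos_of_pos hx0 _).le
    have e : a' x - -γ / ((ℓ - q - 1) * (q + ℓ + 2)) * (q + 2) * x ^ (q + 1)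
        = -(u₂' x * J₁ x - ((ℓ : ℝ) + 1) / (2 * ℓ + 1) * c₁ * x ^ (q + 1))
          - (u' x * J₂ x - -(ℓ : ℝ) * c₂ * x ^ (q + 1)) := by
      rw [← hκ']; simp only [ha']; ring
    rw [e]
    calc |-(u₂' x * J₁ x - ((ℓ : ℝ) + 1) / (2 * ℓ + 1) * c₁ * x ^ (q + 1))
          - (u' x * J₂ x - -(ℓ : ℝ) * c₂ * x ^ (q + 1))|
        ≤ |-(u₂' x * J₁ x - ((ℓ : ℝ) + 1) / (2 * ℓ + 1) * c₁ * x ^ (q + 1))|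
          + |u' x * J₂ x - -(ℓ : ℝ) * c₂ * x ^ (q + 1)| := abs_sub _ _
      _ ≤ C3 * x ^ (q + 1 - 1 / 2) + C4 * x ^ (q + 1 - 1 / 2) := by
          rw [abs_neg]; exact add_le_add (hC3 x hx) (hC4 x hx)
      _ ≤ (C1 + C2 + C3 + C4) * x ^ (q + 1 - 1 / 2) := by nlinarith

end Literature.Analysis.ODE
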